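import Summits.CriticalPhenomena.PercolationContinuityZ3.Theorems.PercNearOneGluingNoHeavyLowerTailSahiOneStepGoodPivotReduction
import Summits.CriticalPhenomena.PercolationContinuityZ3.Theorems.PercNearOneGluingNoHeavyLowerTailSahiOneStepOneShared
import HarnessLib

/-!
# One-step scheme: the DECOUPLING reduction of `(2′)` — induction on the number of SHARED coordinates

Prover prim-ineq-prove-3 gen 40 (`--supports stmt-CriticalPhenomena-4575`; memo
`run/shared/lean/prim/prim-ineq-prove-3/FINDING-G40-DECOUPLING.md` §0(i), §6).  No definitions, no sorries.

Setting: a counted block `F`, the threshold slot `H = {N_F ≥ t}`, `L = Hᶜ`, increasing events `A, B` determined by finite sets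
`S_A, S_B ⊆ F`.  For a coordinate `i` the `1`-section of `B` is the increasing, `i`-free event `B¹_i = {ω | insert i ω ∈ B}`, determined by
`S_B ∖ {i}`.  The pairs `(A, B¹_i)` and `(A¹_i, B)` therefore share one coordinate fewer than `(A, B)`.
* `osN_ind_ind_nonneg_of_inter_compl_null` — the DEGENERATE case: if `μ(A ∩ B ∩ Hᶜ) = 0` then `n(H;A,B) = (1−μH)·Cov(A,B) +
  μ(A∖H)μ(B∖H) ≥ 0` (Harris), for an arbitrary first event `H`.
* **`osN_threshold_nonneg_of_decouplingStep`** — the reduction: if for every level `t`, every pair of increasing events `A, B`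
  determined by subsets `S_A, S_B ⊆ F`, and EVERY coordinate `i ∈ S_A ∩ S_B` that is essential for both events, the non-degenerate pair
  (`μ(A ∩ B ∩ L) > 0`) satisfies the DECOUPLING STEP INEQUALITY
      `p_i · min( n_t(A, B¹_i), n_t(A¹_i, B) ) ≤ n_t(A, B)`,
  then `n_t(A,B) ≥ 0` for every `t` and ALL increasing `A, B` (the pairs not determined by `F` are peeled by
  `osMp_osN_nonneg_of_determined`).  Proof: strong induction on `#(S_A ∩ S_B)`; base = disjoint supports (`osN_disjoint_nonneg`, gen 25, negative
  association of the Hamming ball); an inessential shared coordinate is erased from the determining set; an essential one is decoupled by the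
  hypothesis, whose right-hand side is nonnegative by the induction hypothesis.
* `sahiE3_threshold_nonneg_of_decouplingStep` — hence Kahn C5 / Sahi `C₃` (`E₃(1_{N_F ≥ t}, 1_A, 1_B) ≥ 0`) for every level and ALL pairs.
The step inequality (memo §6, "V3") is exact bookkeeping away from a boundary-layer statement: `n_t(A,B) − p_i·n_t(A,B¹_i) = q_i·n_t(A,B⁰_i) +
μ(L)·p_iq_i·[μ(A¹_i ∩ P_B ∩ ∂_i) + μ(P_A ∩ P_B ∩ {N_{F∖i} ≥ t}) − μ(A ∣ L)·μ(P_B ∩ ∂_i)]` (`P_X = X¹_i ∖ X⁰_i`, `∂_i = {N_{F∖i} = t−1}`); it held in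
190 861 / 190 861 random structured (pair, i) instances on ≤ 8 coordinates and for every pair of up-sets of `2^4` under 6 022 negatively associated
down-set conditionings; each of its two sides alone is false.  Unlike the pivot / window hypotheses (`…GoodPivotReduction`, `…Window`) it involves
no CHOICE of coordinate.
-/

noncomputable section

namespace Summit.CriticalPhenomena.PercolationContinuityZ3.Theorems

namespace SahiOneStep

open MeasureTheory Finset
open Literature.Probability.Percolation (DeterminedBy determinedBy_iff determinedBy_univ)
open Literature.Probability.LatticeModels (prodBernoulli sahiE3 prodBernoulli_harris)
open Literature.Probability.Percolation.DecisionTree (ind)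
open SahiE3Sections (determinedBy_section_insert determinedBy_section_sdiff)
open scoped Classical

variable {ι : Type*} [Fintype ι]

/-! ## The degenerate case -/

/-- **Degenerate pairs.**  For an arbitrary first event `H` and increasing `A, B`: if `μ(A ∩ B ∩ Hᶜ) = 0` then
`n(H;A,B) = (1 − μH)·(μ(A∩B) − μAμB) + (μA − μ(H∩A))·(μB − μ(H∩B)) ≥ 0` by Harris. [this work] -/
theorem osN_ind_ind_nonneg_of_inter_compl_null (p : ι → unitInterval) (H : Set (Set ι)) {A B : Set (Set ι)}
    (hA : IsUpperSet A) (hB : IsUpperSet B) (h0 : (prodBernoulli p).real ((A ∩ B) \ H) = 0) :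
    0 ≤ osN p H (ind A) (ind B) := by
  set μ := prodBernoulli p with hμ
  have hHar : μ.real A * μ.real B ≤ μ.real (A ∩ B) :=
    prodBernoulli_harris p hA hB MeasurableSet.of_discrete MeasurableSet.of_discrete
  have hsplit : μ.real ((A ∩ B) ∩ H) + μ.real ((A ∩ B) \ H) = μ.real (A ∩ B) :=
    measureReal_inter_add_sdiff (μ := μ) (s := A ∩ B) (t := H) MeasurableSet.of_discrete
  have hHAB : μ.real (H ∩ A ∩ B) = μ.real (A ∩ B) := by
    have : H ∩ A ∩ B = (A ∩ B) ∩ H := by ext ω; simp only [Set.mem_inter_iff]; tauto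
    rw [this]; linarith
  have hHA : μ.real (H ∩ A) ≤ μ.real A := measureReal_mono Set.inter_subset_right
  have hHB : μ.real (H ∩ B) ≤ μ.real B := measureReal_mono Set.inter_subset_right
  have hH1 : μ.real H ≤ 1 := measureReal_le_one
  have hAn : 0 ≤ μ.real A := measureReal_nonneg
  have hBn : 0 ≤ μ.real B := measureReal_nonneg
  rw [osN_ind_ind, hHAB]
  nlinarith [mul_nonneg (sub_nonneg.2 hHA) (sub_nonneg.2 hHB), mul_nonneg (sub_nonneg.2 hH1) (sub_nonneg.2 hHar)]

/-! ## The reduction -/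

/-- **REDUCTION OF `(2′)` TO THE DECOUPLING STEP INEQUALITY (induction on the number of shared counted coordinates).**  Suppose that for
every level `t`, all increasing `A, B` determined by `S_A, S_B ⊆ F`, and every `i ∈ S_A ∩ S_B` essential for both (`A` is not
determined by `S_A ∖ i`, nor `B` by `S_B ∖ i`), whenever `μ(A ∩ B ∩ {N_F < t}) > 0`:
`p_i · min(n_t(A, B¹_i), n_t(A¹_i, B)) ≤ n_t(A, B)`.  Then `n_t(A,B) ≥ 0` for every `t` and ALL increasing `A, B`. [this work] -/
theorem osN_threshold_nonneg_of_decouplingStep (p : ι → unitInterval) (F : Finset ι)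
    (hstep : ∀ (t : ℕ) (A B : Set (Set ι)) (SA SB : Finset ι) (i : ι), IsUpperSet A → IsUpperSet B →
      DeterminedBy A (↑SA : Set ι) → DeterminedBy B (↑SB : Set ι) → SA ⊆ F → SB ⊆ F → i ∈ SA → i ∈ SB →
      ¬ DeterminedBy A (↑(SA.erase i) : Set ι) → ¬ DeterminedBy B (↑(SB.erase i) : Set ι) →
      0 < (prodBernoulli p).real (A ∩ B ∩ {ω : Set ι | (F.filter (· ∈ ω)).card < t}) →
      (p i : ℝ) * min (osN p {ω : Set ι | t ≤ (F.filter (· ∈ ω)).card} (ind A) (ind {ω : Set ι | insert i ω ∈ B}))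
          (osN p {ω : Set ι | t ≤ (F.filter (· ∈ ω)).card} (ind {ω : Set ι | insert i ω ∈ A}) (ind B)) ≤
        osN p {ω : Set ι | t ≤ (F.filter (· ∈ ω)).card} (ind A) (ind B))
    (t : ℕ) {A B : Set (Set ι)} (hA : IsUpperSet A) (hB : IsUpperSet B) :
    0 ≤ osN p {ω : Set ι | t ≤ (F.filter (· ∈ ω)).card} (ind A) (ind B) := by
  -- Step 1: pairs determined by subsets of `F`, by strong induction on the number of shared determining coordinates.
  have key : ∀ (n : ℕ) (SA SB : Finset ι), (SA ∩ SB).card = n → SA ⊆ F → SB ⊆ F → ∀ (A B : Set (Set ι)),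
      IsUpperSet A → IsUpperSet B → DeterminedBy A (↑SA : Set ι) → DeterminedBy B (↑SB : Set ι) →
      0 ≤ osN p {ω : Set ι | t ≤ (F.filter (· ∈ ω)).card} (ind A) (ind B) := by
    intro n
    induction n using Nat.strong_induction_on with
    | _ n ih =>
    intro SA SB hn hSAF hSBF A B hA hB hAS hBS
    -- degenerate pairs
    by_cases hdeg : 0 < (prodBernoulli p).real (A ∩ B ∩ {ω : Set ι | (F.filter (· ∈ ω)).card < t})
    swap
    · refine osN_ind_ind_nonneg_of_inter_compl_null p _ hA hB (le_antisymm ?_ measureReal_nonneg)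
      have hset : (A ∩ B) \ {ω : Set ι | t ≤ (F.filter (· ∈ ω)).card} = A ∩ B ∩ {ω : Set ι | (F.filter (· ∈ ω)).card < t} := by
        ext ω; simp only [Set.mem_sdiff, Set.mem_inter_iff, Set.mem_setOf_eq, not_le]
      rw [hset]; exact not_lt.1 hdeg
    -- disjoint determining sets: negative association of the ball
    by_cases hdisj : Disjoint SA SB
    · exact osN_disjoint_nonneg p F t hA hB hAS hBS hdisj
    obtain ⟨i, hi⟩ : (SA ∩ SB).Nonempty := by
      rw [Finset.nonempty_iff_ne_empty]; intro h; exact hdisj (Finset.disjoint_iff_inter_eq_empty.2 h)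
    have hiA : i ∈ SA := (Finset.mem_inter.1 hi).1
    have hiB : i ∈ SB := (Finset.mem_inter.1 hi).2
    have hcardA : (SA.erase i ∩ SB).card < n := by
      rw [← hn]; apply Finset.card_lt_card
      refine ⟨fun j hj => Finset.mem_inter.2 ⟨Finset.mem_of_mem_erase (Finset.mem_inter.1 hj).1, (Finset.mem_inter.1 hj).2⟩, ?_⟩
      intro hsub; have := Finset.mem_inter.1 (hsub hi); exact Finset.notMem_erase i SA this.1
    have hcardB : (SA ∩ SB.erase i).card < n := by
      rw [← hn]; apply Finset.card_lt_card
      refine ⟨fun j hj => Finset.mem_inter.2 ⟨(Finset.mem_inter.1 hj).1, Finset.mem_of_mem_erase (Finset.mem_inter.1 hj).2⟩, ?_⟩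
      intro hsub; have := Finset.mem_inter.1 (hsub hi); exact Finset.notMem_erase i SB this.2
    have hSAF' : SA.erase i ⊆ F := (Finset.erase_subset i SA).trans hSAF
    have hSBF' : SB.erase i ⊆ F := (Finset.erase_subset i SB).trans hSBF
    -- inessential shared coordinate: shrink the determining set
    by_cases hAi : DeterminedBy A (↑(SA.erase i) : Set ι)
    · exact ih _ hcardA (SA.erase i) SB rfl hSAF' hSBF A B hA hB hAi hBS
    by_cases hBi : DeterminedBy B (↑(SB.erase i) : Set ι)
    · exact ih _ hcardB SA (SB.erase i) rfl hSAF hSBF' A B hA hB hAS hBi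
    -- essential shared coordinate: decouple
    have hV := hstep t A B SA SB i hA hB hAS hBS hSAF hSBF hiA hiB hAi hBi hdeg
    have hcoeA : (↑SA : Set ι) \ {i} = ↑(SA.erase i) := by rw [Finset.coe_erase]
    have hcoeB : (↑SB : Set ι) \ {i} = ↑(SB.erase i) := by rw [Finset.coe_erase]
    have hB1 : DeterminedBy {ω : Set ι | insert i ω ∈ B} (↑(SB.erase i) : Set ι) := hcoeB ▸ determinedBy_section_insert hBS i
    have hA1 : DeterminedBy {ω : Set ι | insert i ω ∈ A} (↑(SA.erase i) : Set ι) := hcoeA ▸ determinedBy_section_insert hAS i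
    have h1 : 0 ≤ osN p {ω : Set ι | t ≤ (F.filter (· ∈ ω)).card} (ind A) (ind {ω : Set ι | insert i ω ∈ B}) :=
      ih _ hcardB SA (SB.erase i) rfl hSAF hSBF' A _ hA (isUpperSet_section_insert hB i) hAS hB1
    have h2 : 0 ≤ osN p {ω : Set ι | t ≤ (F.filter (· ∈ ω)).card} (ind {ω : Set ι | insert i ω ∈ A}) (ind B) :=
      ih _ hcardA (SA.erase i) SB rfl hSAF' hSBF _ B (isUpperSet_section_insert hA i) hB hA1 hBS
    have hp0 : 0 ≤ (p i : ℝ) := (p i).2.1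
    exact le_trans (mul_nonneg hp0 (le_min h1 h2)) hV
  -- Step 2: peel the coordinates outside `F`.
  exact (osMp_osN_nonneg_of_determined p (determinedBy_threshold F t)
    (fun A' B' hA' hB' _ _ => osMp_threshold_nonneg_all p F t hA' hB')
    (fun A' B' hA' hB' hA'F hB'F => key _ F F rfl subset_rfl subset_rfl A' B' hA' hB' hA'F hB'F) hA hB).2

/-- **KAHN C5 / SAHI `C₃` FOR A THRESHOLD FIRST SLOT, ALL PAIRS, FROM THE DECOUPLING STEP INEQUALITY.**  Under the hypothesis of
`osN_threshold_nonneg_of_decouplingStep`: `0 ≤ E₃(1_{N_F ≥ t}, 1_A, 1_B)` for every level `t` and ALL increasing `A, B`. [this work] -/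
theorem sahiE3_threshold_nonneg_of_decouplingStep (p : ι → unitInterval) (F : Finset ι)
    (hstep : ∀ (t : ℕ) (A B : Set (Set ι)) (SA SB : Finset ι) (i : ι), IsUpperSet A → IsUpperSet B →
      DeterminedBy A (↑SA : Set ι) → DeterminedBy B (↑SB : Set ι) → SA ⊆ F → SB ⊆ F → i ∈ SA → i ∈ SB →
      ¬ DeterminedBy A (↑(SA.erase i) : Set ι) → ¬ DeterminedBy B (↑(SB.erase i) : Set ι) →
      0 < (prodBernoulli p).real (A ∩ B ∩ {ω : Set ι | (F.filter (· ∈ ω)).card < t}) →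
      (p i : ℝ) * min (osN p {ω : Set ι | t ≤ (F.filter (· ∈ ω)).card} (ind A) (ind {ω : Set ι | insert i ω ∈ B}))
          (osN p {ω : Set ι | t ≤ (F.filter (· ∈ ω)).card} (ind {ω : Set ι | insert i ω ∈ A}) (ind B)) ≤
        osN p {ω : Set ι | t ≤ (F.filter (· ∈ ω)).card} (ind A) (ind B))
    (t : ℕ) {A B : Set (Set ι)} (hA : IsUpperSet A) (hB : IsUpperSet B) :
    0 ≤ sahiE3 (prodBernoulli p) {ω : Set ι | t ≤ (F.filter (· ∈ ω)).card} A B := by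
  rw [← osT_ind_ind, osT_eq_osMp_add_osN]
  exact add_nonneg (osMp_threshold_nonneg_all p F t hA hB) (osN_threshold_nonneg_of_decouplingStep p F hstep t hA hB)

/-! ## The existence ("choice") form of the reduction

The universal form of the step inequality (hypothesis of `osN_threshold_nonneg_of_decouplingStep`: EVERY essential shared coordinate) is
FALSE (gen 40, exact): `F = {0,…,6}`, `t = 3`, `A = x₀ ∨ x₂x₃x₅`, `B = x₁ ∨ x₂x₄ ∨ x₃x₄x₅`,
`p = (.996982, .205916, .527874, .996982, .16165, .996982, .062132)`: at the heavy shared coordinates `i = 3, 5` both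
`n_t(A,B) − p_i n_t(A,B¹_i) = −5.0·10⁻⁸` and `n_t(A,B) − p_i n_t(A¹_i,B) = −2.4·10⁻¹⁰` (while `n_t(A,B) = 1.27·10⁻⁶ > 0`), but at the third shared
coordinate `i = 2` the inequality holds with margin `n_t/2`.  The induction only ever needs ONE good shared coordinate per pair, so the
operative hypothesis is the existence form below (no counterexample known: adversarial search kit j246297 + the census of the memo §6). -/

/-- **REDUCTION OF `(2′)` TO THE DECOUPLING STEP INEQUALITY AT SOME SHARED COORDINATE.**  Suppose that for every level `t` and all
increasing `A, B` determined by `S_A, S_B ⊆ F` such that every `i ∈ S_A ∩ S_B` is essential for both events and `S_A ∩ S_B ≠ ∅`, whenever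
`μ(A ∩ B ∩ {N_F < t}) > 0` there is SOME `i ∈ S_A ∩ S_B` with `p_i · min(n_t(A,B¹_i), n_t(A¹_i,B)) ≤ n_t(A,B)`.  Then `n_t(A,B) ≥ 0` for every `t`
and ALL increasing `A, B`. [this work] -/
theorem osN_threshold_nonneg_of_decouplingChoice (p : ι → unitInterval) (F : Finset ι)
    (hstep : ∀ (t : ℕ) (A B : Set (Set ι)) (SA SB : Finset ι), IsUpperSet A → IsUpperSet B →
      DeterminedBy A (↑SA : Set ι) → DeterminedBy B (↑SB : Set ι) → SA ⊆ F → SB ⊆ F → (SA ∩ SB).Nonempty →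
      (∀ i ∈ SA ∩ SB, ¬ DeterminedBy A (↑(SA.erase i) : Set ι) ∧ ¬ DeterminedBy B (↑(SB.erase i) : Set ι)) →
      0 < (prodBernoulli p).real (A ∩ B ∩ {ω : Set ι | (F.filter (· ∈ ω)).card < t}) →
      ∃ i ∈ SA ∩ SB,
        (p i : ℝ) * min (osN p {ω : Set ι | t ≤ (F.filter (· ∈ ω)).card} (ind A) (ind {ω : Set ι | insert i ω ∈ B}))
            (osN p {ω : Set ι | t ≤ (F.filter (· ∈ ω)).card} (ind {ω : Set ι | insert i ω ∈ A}) (ind B)) ≤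
          osN p {ω : Set ι | t ≤ (F.filter (· ∈ ω)).card} (ind A) (ind B))
    (t : ℕ) {A B : Set (Set ι)} (hA : IsUpperSet A) (hB : IsUpperSet B) :
    0 ≤ osN p {ω : Set ι | t ≤ (F.filter (· ∈ ω)).card} (ind A) (ind B) := by
  have key : ∀ (n : ℕ) (SA SB : Finset ι), (SA ∩ SB).card = n → SA ⊆ F → SB ⊆ F → ∀ (A B : Set (Set ι)),
      IsUpperSet A → IsUpperSet B → DeterminedBy A (↑SA : Set ι) → DeterminedBy B (↑SB : Set ι) →
      0 ≤ osN p {ω : Set ι | t ≤ (F.filter (· ∈ ω)).card} (ind A) (ind B) := by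
    intro n
    induction n using Nat.strong_induction_on with
    | _ n ih =>
    intro SA SB hn hSAF hSBF A B hA hB hAS hBS
    by_cases hdeg : 0 < (prodBernoulli p).real (A ∩ B ∩ {ω : Set ι | (F.filter (· ∈ ω)).card < t})
    swap
    · refine osN_ind_ind_nonneg_of_inter_compl_null p _ hA hB (le_antisymm ?_ measureReal_nonneg)
      have hset : (A ∩ B) \ {ω : Set ι | t ≤ (F.filter (· ∈ ω)).card} = A ∩ B ∩ {ω : Set ι | (F.filter (· ∈ ω)).card < t} := by
        ext ω; simp only [Set.mem_sdiff, Set.mem_inter_iff, Set.mem_setOf_eq, not_le]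
      rw [hset]; exact not_lt.1 hdeg
    by_cases hdisj : Disjoint SA SB
    · exact osN_disjoint_nonneg p F t hA hB hAS hBS hdisj
    have hne : (SA ∩ SB).Nonempty := by
      rw [Finset.nonempty_iff_ne_empty]; intro h; exact hdisj (Finset.disjoint_iff_inter_eq_empty.2 h)
    -- erasing a shared coordinate lowers the number of shared determining coordinates
    have hcardA : ∀ i ∈ SA ∩ SB, (SA.erase i ∩ SB).card < n := by
      intro i hi; rw [← hn]; apply Finset.card_lt_card
      refine ⟨fun j hj => Finset.mem_inter.2 ⟨Finset.mem_of_mem_erase (Finset.mem_inter.1 hj).1, (Finset.mem_inter.1 hj).2⟩, ?_⟩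
      intro hsub; have := Finset.mem_inter.1 (hsub hi); exact Finset.notMem_erase i SA this.1
    have hcardB : ∀ i ∈ SA ∩ SB, (SA ∩ SB.erase i).card < n := by
      intro i hi; rw [← hn]; apply Finset.card_lt_card
      refine ⟨fun j hj => Finset.mem_inter.2 ⟨(Finset.mem_inter.1 hj).1, Finset.mem_of_mem_erase (Finset.mem_inter.1 hj).2⟩, ?_⟩
      intro hsub; have := Finset.mem_inter.1 (hsub hi); exact Finset.notMem_erase i SB this.2
    -- an inessential shared coordinate: shrink the determining set
    by_cases hess : ∀ i ∈ SA ∩ SB, ¬ DeterminedBy A (↑(SA.erase i) : Set ι) ∧ ¬ DeterminedBy B (↑(SB.erase i) : Set ι)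
    swap
    · push Not at hess
      obtain ⟨i, hi, hi'⟩ := hess
      by_cases hAi : DeterminedBy A (↑(SA.erase i) : Set ι)
      · exact ih _ (hcardA i hi) (SA.erase i) SB rfl ((Finset.erase_subset i SA).trans hSAF) hSBF A B hA hB hAi hBS
      · exact ih _ (hcardB i hi) SA (SB.erase i) rfl hSAF ((Finset.erase_subset i SB).trans hSBF) A B hA hB hAS (hi' hAi)
    -- all shared coordinates essential: decouple at the good one
    obtain ⟨i, hi, hV⟩ := hstep t A B SA SB hA hB hAS hBS hSAF hSBF hne hess hdeg
    have hcoeA : (↑SA : Set ι) \ {i} = ↑(SA.erase i) := by rw [Finset.coe_erase]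
    have hcoeB : (↑SB : Set ι) \ {i} = ↑(SB.erase i) := by rw [Finset.coe_erase]
    have hB1 : DeterminedBy {ω : Set ι | insert i ω ∈ B} (↑(SB.erase i) : Set ι) := hcoeB ▸ determinedBy_section_insert hBS i
    have hA1 : DeterminedBy {ω : Set ι | insert i ω ∈ A} (↑(SA.erase i) : Set ι) := hcoeA ▸ determinedBy_section_insert hAS i
    have h1 : 0 ≤ osN p {ω : Set ι | t ≤ (F.filter (· ∈ ω)).card} (ind A) (ind {ω : Set ι | insert i ω ∈ B}) :=
      ih _ (hcardB i hi) SA (SB.erase i) rfl hSAF ((Finset.erase_subset i SB).trans hSBF) A _ hA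
        (isUpperSet_section_insert hB i) hAS hB1
    have h2 : 0 ≤ osN p {ω : Set ι | t ≤ (F.filter (· ∈ ω)).card} (ind {ω : Set ι | insert i ω ∈ A}) (ind B) :=
      ih _ (hcardA i hi) (SA.erase i) SB rfl ((Finset.erase_subset i SA).trans hSAF) hSBF _ B
        (isUpperSet_section_insert hA i) hB hA1 hBS
    exact le_trans (mul_nonneg (p i).2.1 (le_min h1 h2)) hV
  exact (osMp_osN_nonneg_of_determined p (determinedBy_threshold F t)
    (fun A' B' hA' hB' _ _ => osMp_threshold_nonneg_all p F t hA' hB')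
    (fun A' B' hA' hB' hA'F hB'F => key _ F F rfl subset_rfl subset_rfl A' B' hA' hB' hA'F hB'F) hA hB).2

/-- **KAHN C5 / SAHI `C₃` FOR A THRESHOLD FIRST SLOT, ALL PAIRS, FROM THE EXISTENCE FORM OF THE DECOUPLING STEP INEQUALITY.**
Under the hypothesis of `osN_threshold_nonneg_of_decouplingChoice`: `0 ≤ E₃(1_{N_F ≥ t}, 1_A, 1_B)` for every level `t` and ALL
increasing `A, B`. [this work] -/
theorem sahiE3_threshold_nonneg_of_decouplingChoice (p : ι → unitInterval) (F : Finset ι)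
    (hstep : ∀ (t : ℕ) (A B : Set (Set ι)) (SA SB : Finset ι), IsUpperSet A → IsUpperSet B →
      DeterminedBy A (↑SA : Set ι) → DeterminedBy B (↑SB : Set ι) → SA ⊆ F → SB ⊆ F → (SA ∩ SB).Nonempty →
      (∀ i ∈ SA ∩ SB, ¬ DeterminedBy A (↑(SA.erase i) : Set ι) ∧ ¬ DeterminedBy B (↑(SB.erase i) : Set ι)) →
      0 < (prodBernoulli p).real (A ∩ B ∩ {ω : Set ι | (F.filter (· ∈ ω)).card < t}) →
      ∃ i ∈ SA ∩ SB,
        (p i : ℝ) * min (osN p {ω : Set ι | t ≤ (F.filter (· ∈ ω)).card} (ind A) (ind {ω : Set ι | insert i ω ∈ B}))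
            (osN p {ω : Set ι | t ≤ (F.filter (· ∈ ω)).card} (ind {ω : Set ι | insert i ω ∈ A}) (ind B)) ≤
          osN p {ω : Set ι | t ≤ (F.filter (· ∈ ω)).card} (ind A) (ind B))
    (t : ℕ) {A B : Set (Set ι)} (hA : IsUpperSet A) (hB : IsUpperSet B) :
    0 ≤ sahiE3 (prodBernoulli p) {ω : Set ι | t ≤ (F.filter (· ∈ ω)).card} A B := by
  rw [← osT_ind_ind, osT_eq_osMp_add_osN]
  exact add_nonneg (osMp_threshold_nonneg_all p F t hA hB) (osN_threshold_nonneg_of_decouplingChoice p F hstep t hA hB)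

/-! ## The four-borrowings form ("V36")

At a light shared coordinate the `1`-section borrowing `n_t(A,B) ≥ p_i·n_t(A,B¹_i)` is natural (its slack is `q_i·n_t(A,B⁰_i)`), at a heavy one
the `0`-section borrowing `n_t(A,B) ≥ q_i·n_t(A,B⁰_i)` is (slack `p_i·n_t(A,B¹_i)`); both universal one-direction forms are false at the opposite
extreme (gen 40 census and the `n = 6, 7` killers above).  The form below asks, at EVERY essential shared coordinate, for ONE of the four
borrowings (two sections × two sides); it had no counterexample in the gen-40 census (random `n ≤ 8`, adversarial `n ≤ 12`), and it still closes
the induction on the number of shared coordinates because all four section pairs share one coordinate fewer. -/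

/-- **REDUCTION OF `(2′)` TO THE FOUR-BORROWINGS STEP INEQUALITY.**  Suppose that for every level `t`, all increasing `A, B` determined by
`S_A, S_B ⊆ F`, and every `i ∈ S_A ∩ S_B` essential for both, whenever `μ(A ∩ B ∩ {N_F < t}) > 0`:
`min( p_i·min(n_t(A,B¹_i), n_t(A¹_i,B)), (1−p_i)·min(n_t(A,B⁰_i), n_t(A⁰_i,B)) ) ≤ n_t(A,B)`
(`X¹_i = {ω | insert i ω ∈ X}`, `X⁰_i = {ω | ω ∖ {i} ∈ X}`).  Then `n_t(A,B) ≥ 0` for every `t` and ALL increasing `A, B`. [this work] -/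
theorem osN_threshold_nonneg_of_fourBorrowings (p : ι → unitInterval) (F : Finset ι)
    (hstep : ∀ (t : ℕ) (A B : Set (Set ι)) (SA SB : Finset ι) (i : ι), IsUpperSet A → IsUpperSet B →
      DeterminedBy A (↑SA : Set ι) → DeterminedBy B (↑SB : Set ι) → SA ⊆ F → SB ⊆ F → i ∈ SA → i ∈ SB →
      ¬ DeterminedBy A (↑(SA.erase i) : Set ι) → ¬ DeterminedBy B (↑(SB.erase i) : Set ι) →
      0 < (prodBernoulli p).real (A ∩ B ∩ {ω : Set ι | (F.filter (· ∈ ω)).card < t}) →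
      min ((p i : ℝ) * min (osN p {ω : Set ι | t ≤ (F.filter (· ∈ ω)).card} (ind A) (ind {ω : Set ι | insert i ω ∈ B}))
              (osN p {ω : Set ι | t ≤ (F.filter (· ∈ ω)).card} (ind {ω : Set ι | insert i ω ∈ A}) (ind B)))
          ((1 - p i) * min (osN p {ω : Set ι | t ≤ (F.filter (· ∈ ω)).card} (ind A) (ind {ω : Set ι | ω \ {i} ∈ B}))
              (osN p {ω : Set ι | t ≤ (F.filter (· ∈ ω)).card} (ind {ω : Set ι | ω \ {i} ∈ A}) (ind B))) ≤
        osN p {ω : Set ι | t ≤ (F.filter (· ∈ ω)).card} (ind A) (ind B))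
    (t : ℕ) {A B : Set (Set ι)} (hA : IsUpperSet A) (hB : IsUpperSet B) :
    0 ≤ osN p {ω : Set ι | t ≤ (F.filter (· ∈ ω)).card} (ind A) (ind B) := by
  have key : ∀ (n : ℕ) (SA SB : Finset ι), (SA ∩ SB).card = n → SA ⊆ F → SB ⊆ F → ∀ (A B : Set (Set ι)),
      IsUpperSet A → IsUpperSet B → DeterminedBy A (↑SA : Set ι) → DeterminedBy B (↑SB : Set ι) →
      0 ≤ osN p {ω : Set ι | t ≤ (F.filter (· ∈ ω)).card} (ind A) (ind B) := by
    intro n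
    induction n using Nat.strong_induction_on with
    | _ n ih =>
    intro SA SB hn hSAF hSBF A B hA hB hAS hBS
    by_cases hdeg : 0 < (prodBernoulli p).real (A ∩ B ∩ {ω : Set ι | (F.filter (· ∈ ω)).card < t})
    swap
    · refine osN_ind_ind_nonneg_of_inter_compl_null p _ hA hB (le_antisymm ?_ measureReal_nonneg)
      have hset : (A ∩ B) \ {ω : Set ι | t ≤ (F.filter (· ∈ ω)).card} = A ∩ B ∩ {ω : Set ι | (F.filter (· ∈ ω)).card < t} := by
        ext ω; simp only [Set.mem_sdiff, Set.mem_inter_iff, Set.mem_setOf_eq, not_le]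
      rw [hset]; exact not_lt.1 hdeg
    by_cases hdisj : Disjoint SA SB
    · exact osN_disjoint_nonneg p F t hA hB hAS hBS hdisj
    obtain ⟨i, hi⟩ : (SA ∩ SB).Nonempty := by
      rw [Finset.nonempty_iff_ne_empty]; intro h; exact hdisj (Finset.disjoint_iff_inter_eq_empty.2 h)
    have hiA : i ∈ SA := (Finset.mem_inter.1 hi).1
    have hiB : i ∈ SB := (Finset.mem_inter.1 hi).2
    have hcardA : (SA.erase i ∩ SB).card < n := by
      rw [← hn]; apply Finset.card_lt_card
      refine ⟨fun j hj => Finset.mem_inter.2 ⟨Finset.mem_of_mem_erase (Finset.mem_inter.1 hj).1, (Finset.mem_inter.1 hj).2⟩, ?_⟩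
      intro hsub; have := Finset.mem_inter.1 (hsub hi); exact Finset.notMem_erase i SA this.1
    have hcardB : (SA ∩ SB.erase i).card < n := by
      rw [← hn]; apply Finset.card_lt_card
      refine ⟨fun j hj => Finset.mem_inter.2 ⟨(Finset.mem_inter.1 hj).1, Finset.mem_of_mem_erase (Finset.mem_inter.1 hj).2⟩, ?_⟩
      intro hsub; have := Finset.mem_inter.1 (hsub hi); exact Finset.notMem_erase i SB this.2
    have hSAF' : SA.erase i ⊆ F := (Finset.erase_subset i SA).trans hSAF
    have hSBF' : SB.erase i ⊆ F := (Finset.erase_subset i SB).trans hSBF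
    by_cases hAi : DeterminedBy A (↑(SA.erase i) : Set ι)
    · exact ih _ hcardA (SA.erase i) SB rfl hSAF' hSBF A B hA hB hAi hBS
    by_cases hBi : DeterminedBy B (↑(SB.erase i) : Set ι)
    · exact ih _ hcardB SA (SB.erase i) rfl hSAF hSBF' A B hA hB hAS hBi
    have hV := hstep t A B SA SB i hA hB hAS hBS hSAF hSBF hiA hiB hAi hBi hdeg
    have hcoeA : (↑SA : Set ι) \ {i} = ↑(SA.erase i) := by rw [Finset.coe_erase]
    have hcoeB : (↑SB : Set ι) \ {i} = ↑(SB.erase i) := by rw [Finset.coe_erase]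
    have hB1 : DeterminedBy {ω : Set ι | insert i ω ∈ B} (↑(SB.erase i) : Set ι) := hcoeB ▸ determinedBy_section_insert hBS i
    have hA1 : DeterminedBy {ω : Set ι | insert i ω ∈ A} (↑(SA.erase i) : Set ι) := hcoeA ▸ determinedBy_section_insert hAS i
    have hB0 : DeterminedBy {ω : Set ι | ω \ {i} ∈ B} (↑(SB.erase i) : Set ι) := hcoeB ▸ determinedBy_section_sdiff hBS i
    have hA0 : DeterminedBy {ω : Set ι | ω \ {i} ∈ A} (↑(SA.erase i) : Set ι) := hcoeA ▸ determinedBy_section_sdiff hAS i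
    have h1 : 0 ≤ osN p {ω : Set ι | t ≤ (F.filter (· ∈ ω)).card} (ind A) (ind {ω : Set ι | insert i ω ∈ B}) :=
      ih _ hcardB SA (SB.erase i) rfl hSAF hSBF' A _ hA (isUpperSet_section_insert hB i) hAS hB1
    have h2 : 0 ≤ osN p {ω : Set ι | t ≤ (F.filter (· ∈ ω)).card} (ind {ω : Set ι | insert i ω ∈ A}) (ind B) :=
      ih _ hcardA (SA.erase i) SB rfl hSAF' hSBF _ B (isUpperSet_section_insert hA i) hB hA1 hBS
    have h3 : 0 ≤ osN p {ω : Set ι | t ≤ (F.filter (· ∈ ω)).card} (ind A) (ind {ω : Set ι | ω \ {i} ∈ B}) :=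
      ih _ hcardB SA (SB.erase i) rfl hSAF hSBF' A _ hA (isUpperSet_section_sdiff hB i) hAS hB0
    have h4 : 0 ≤ osN p {ω : Set ι | t ≤ (F.filter (· ∈ ω)).card} (ind {ω : Set ι | ω \ {i} ∈ A}) (ind B) :=
      ih _ hcardA (SA.erase i) SB rfl hSAF' hSBF _ B (isUpperSet_section_sdiff hA i) hB hA0 hBS
    have hp0 : 0 ≤ (p i : ℝ) := (p i).2.1
    have hq0 : 0 ≤ 1 - (p i : ℝ) := sub_nonneg.2 (p i).2.2
    exact le_trans (le_min (mul_nonneg hp0 (le_min h1 h2)) (mul_nonneg hq0 (le_min h3 h4))) hV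
  exact (osMp_osN_nonneg_of_determined p (determinedBy_threshold F t)
    (fun A' B' hA' hB' _ _ => osMp_threshold_nonneg_all p F t hA' hB')
    (fun A' B' hA' hB' hA'F hB'F => key _ F F rfl subset_rfl subset_rfl A' B' hA' hB' hA'F hB'F) hA hB).2

/-- **KAHN C5 / SAHI `C₃` FOR A THRESHOLD FIRST SLOT, ALL PAIRS, FROM THE FOUR-BORROWINGS STEP INEQUALITY.**  Under the hypothesis of
`osN_threshold_nonneg_of_fourBorrowings`: `0 ≤ E₃(1_{N_F ≥ t}, 1_A, 1_B)` for every level `t` and ALL increasing `A, B`. [this work] -/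
theorem sahiE3_threshold_nonneg_of_fourBorrowings (p : ι → unitInterval) (F : Finset ι)
    (hstep : ∀ (t : ℕ) (A B : Set (Set ι)) (SA SB : Finset ι) (i : ι), IsUpperSet A → IsUpperSet B →
      DeterminedBy A (↑SA : Set ι) → DeterminedBy B (↑SB : Set ι) → SA ⊆ F → SB ⊆ F → i ∈ SA → i ∈ SB →
      ¬ DeterminedBy A (↑(SA.erase i) : Set ι) → ¬ DeterminedBy B (↑(SB.erase i) : Set ι) →
      0 < (prodBernoulli p).real (A ∩ B ∩ {ω : Set ι | (F.filter (· ∈ ω)).card < t}) →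
      min ((p i : ℝ) * min (osN p {ω : Set ι | t ≤ (F.filter (· ∈ ω)).card} (ind A) (ind {ω : Set ι | insert i ω ∈ B}))
              (osN p {ω : Set ι | t ≤ (F.filter (· ∈ ω)).card} (ind {ω : Set ι | insert i ω ∈ A}) (ind B)))
          ((1 - p i) * min (osN p {ω : Set ι | t ≤ (F.filter (· ∈ ω)).card} (ind A) (ind {ω : Set ι | ω \ {i} ∈ B}))
              (osN p {ω : Set ι | t ≤ (F.filter (· ∈ ω)).card} (ind {ω : Set ι | ω \ {i} ∈ A}) (ind B))) ≤
        osN p {ω : Set ι | t ≤ (F.filter (· ∈ ω)).card} (ind A) (ind B))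
    (t : ℕ) {A B : Set (Set ι)} (hA : IsUpperSet A) (hB : IsUpperSet B) :
    0 ≤ sahiE3 (prodBernoulli p) {ω : Set ι | t ≤ (F.filter (· ∈ ω)).card} A B := by
  rw [← osT_ind_ind, osT_eq_osMp_add_osN]
  exact add_nonneg (osMp_threshold_nonneg_all p F t hA hB) (osN_threshold_nonneg_of_fourBorrowings p F hstep t hA hB)

end SahiOneStep

end Summit.CriticalPhenomena.PercolationContinuityZ3.Theorems
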